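import Literature.NumberTheory.EllipticCurves.Gamma0AwayGeneration
import Literature.NumberTheory.EllipticCurves.Gamma0AwayCharacterExtension
import Literature.GroupTheory.CombinatorialGroupTheory.AmalgamPingPongCharacter
import HarnessLib

/-!
# PROOF of the named fact `gamma0Away_character_extension_of_shiftInvariant`
# (a `t`-shift-invariant additive character of `Γ₀(L′)` extends additively to `Γ₀(L′; ℤ[1/t])`, `t ∤ L′`)

Topic `Literature/NumberTheory/EllipticCurves`; theorems only; sibling of the statement file
`Gamma0AwayCharacterExtension.lean` (cell bsd-f2-manin candidate E-es-43, «derived reading» of Serre's segment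
criterion for `Δ_t(L′) = Γ₀(L′; ℤ[1/t])` acting on the Bruhat–Tits tree).  This file DISCHARGES the fact:
`gamma0Away_character_extension_of_shiftInvariant_holds`.

The proof does not build the tree.  Instead:

1. the abstract amalgam `P = Γ₀(L′) *_{Γ₀(L′t)} Γ₀(L′)` (Mathlib `Monoid.PushoutI` over `Bool`, glued along the
   inclusion and the degeneracy conjugation `γ ↦ diag(t,1) γ diag(t,1)⁻¹`, both injective: `amalgamMaps_injective`)
   maps to `SL₂(ℤ[1/t])` by `ψ = (ι, θ ∘ ι)`, `θ = Ad(diag(t,1)⁻¹)` — well defined because `θ ∘ ι ∘ δ_t = ι` on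
   `Γ₀(L′t)` (`Gamma0Away.theta_map_degeneracyConj`);
2. the pair of characters `(u, u)` is compatible on `Γ₀(L′t)` — this is LITERALLY the hypothesis `π_t^* u = π_1^* u`
   — so `PushoutI.lift` gives a character of `P`;
3. reduced words of `P` act on `SL₂(ℤ[1/t])` by PING-PONG with respect to the half-tree predicate `TopHeavy` and
   the `height` (`Gamma0AwayPingPong.lean`: (h0) (hL) (hR) (hB); the letters off `Γ₀(L′t)` are exactly the
   `γ` with `t ∤ γ₁₀`, resp. `t ∤ γ₀₁`: `mem_range_inclusion_of_dvd`, `mem_range_degeneracyConj_of_dvd`), hence the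
   character of `P` factors through `ψ(P)`
   (`Literature.GroupTheory.CombinatorialGroupTheory.Amalgam.exists_extension_of_pingPong`);
4. `ψ(P) ⊇ Γ₀(L′; ℤ[1/t])` (`Gamma0AwayGeneration.lean`, `Gamma0Away.mem_of_apply_one_zero`).

(Steps 3–4 together say `ψ : P ≅ Γ₀(L′; ℤ[1/t])`, Serre's theorem; only the consequence for characters is
recorded.)  Nothing about elliptic curves, BSD or the Manin constant is used or proved here; the consumer is
the cell's relative-Ihara descent (crux `ManinOddAtFour`, stmt-BirchSwinnertonDyer-22967, line `kato_shift_two`,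
stub `stub_gamma0AwayExtensionFact`).

## References

* J.-P. Serre, *Trees*, Springer (1980), Ch. I §4.1 Thm. 6; Ch. II §1.1, §1.4 Thm. 3 and Cor. 1. [SerreTrees1980]
* J.-P. Serre, Résumé des cours de 1968–1969, §1.2, §2.2 (Oeuvres II pp. 536–537). [Serre1969ResumeCours]
* R. C. Lyndon, P. E. Schupp, *Combinatorial Group Theory* (2001), Ch. IV Thm. 2.6. [LyndonSchupp2001]
-/

noncomputable section


namespace Literature.NumberTheory.EllipticCurves

open scoped MatrixGroups
open CongruenceSubgroup Monoid Literature.NumberTheory.EllipticCurves.ModularForms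
  Literature.NumberTheory.EllipticCurves.ModularForms.HidaCohomology
  Literature.GroupTheory.CombinatorialGroupTheory

namespace Gamma0Away

section Amalgam

variable (t : ℕ) [Fact t.Prime] (L' : ℕ)

/-- The two embeddings `Γ₀(L′t) → Γ₀(L′)` of the amalgam `Γ₀(L′) *_{Γ₀(L′t)} Γ₀(L′)`: the inclusion
(`b = false`) and the degeneracy conjugation `γ ↦ diag(t,1) γ diag(t,1)⁻¹` (`b = true`) (plumbing).
[cite: SerreTrees1980, Ch. II §1.4 Thm. 3] -/
theorem amalgamMaps_injective [NeZero t] (b : Bool) :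
    Function.Injective ((cond b (Gamma0.degeneracyConj L' (L' * t) t dvd_rfl)
      (Gamma0.degeneracyConj L' (L' * t) 1 (mul_dvd_mul_left L' (one_dvd t))) :
        Gamma0 (L' * t) →* Gamma0 L') : Gamma0 (L' * t) → Gamma0 L') := by
  intro γ₁ γ₂ h
  have ht0 : (t : ℤ) ≠ 0 := by exact_mod_cast (Fact.out : t.Prime).ne_zero
  cases b
  · simp only [cond_false] at h
    have h' := congrArg (fun γ : Gamma0 L' => ((γ : SL(2, ℤ)) : Matrix (Fin 2) (Fin 2) ℤ)) h
    simp only [Gamma0.coe_degeneracyConj_one] at h'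
    exact Subtype.ext (Matrix.SpecialLinearGroup.ext _ _ fun i j => by rw [h'])
  · simp only [cond_true, Gamma0.degeneracyConj_apply] at h
    have hdvd : ∀ γ : Gamma0 (L' * t), (t : ℤ) ∣ (γ : SL(2, ℤ)) 1 0 := by
      intro γ
      have hγ := γ.2
      rw [Gamma0_mem] at hγ
      exact dvd_trans (by push_cast; exact dvd_mul_left _ _) ((ZMod.intCast_zmod_eq_zero_iff_dvd _ _).mp hγ)
    have e := fun i j => congrArg (fun γ : Gamma0 L' => (γ : SL(2, ℤ)) i j) h
    have e00 := e 0 0; have e01 := e 0 1; have e10 := e 1 0; have e11 := e 1 1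
    simp only [Gamma0.degeneracyConjElt_apply_zero_zero, Gamma0.degeneracyConjElt_apply_zero_one,
      Gamma0.degeneracyConjElt_apply_one_zero, Gamma0.degeneracyConjElt_apply_one_one] at e00 e01 e10 e11
    refine Subtype.ext (Matrix.SpecialLinearGroup.ext _ _ fun i j => ?_)
    fin_cases i <;> fin_cases j
    · exact e00
    · exact mul_left_cancel₀ ht0 e01
    · have h1 := Int.ediv_mul_cancel (hdvd γ₁)
      have h2 := Int.ediv_mul_cancel (hdvd γ₂)
      show (γ₁ : SL(2, ℤ)) 1 0 = (γ₂ : SL(2, ℤ)) 1 0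
      rw [← h1, ← h2, e10]
    · exact e11

/-- A matrix of `Γ₀(L′)` whose lower-left entry is divisible by `t` lies in (the image of) `Γ₀(L′t)`
(`t ∤ L′`). [cite: SerreTrees1980, Ch. II §1.4 Thm. 3] -/
theorem mem_range_inclusion_of_dvd (htL : ¬ t ∣ L') (γ : Gamma0 L') (h : (t : ℤ) ∣ (γ : SL(2, ℤ)) 1 0) :
    γ ∈ (Gamma0.degeneracyConj L' (L' * t) 1 (mul_dvd_mul_left L' (one_dvd t))).range := by
  have hL : (L' : ℤ) ∣ (γ : SL(2, ℤ)) 1 0 := by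
    have hγ := γ.2
    rw [Gamma0_mem] at hγ
    exact (ZMod.intCast_zmod_eq_zero_iff_dvd _ _).mp hγ
  have hcop : IsCoprime (L' : ℤ) (t : ℤ) := by
    rw [Nat.isCoprime_iff_coprime]; exact ((Nat.Prime.coprime_iff_not_dvd Fact.out).2 htL).symm
  have hLt : ((L' * t : ℕ) : ℤ) ∣ (γ : SL(2, ℤ)) 1 0 := by push_cast; exact hcop.mul_dvd hL h
  refine ⟨⟨(γ : SL(2, ℤ)), by rw [Gamma0_mem]; exact (ZMod.intCast_zmod_eq_zero_iff_dvd _ _).mpr hLt⟩, ?_⟩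
  apply Subtype.ext
  apply Matrix.SpecialLinearGroup.ext
  intro i j
  rw [Gamma0.coe_degeneracyConj_one]

/-- A matrix of `Γ₀(L′)` whose upper-right entry is divisible by `t` lies in the image of `Γ₀(L′t)` under the
degeneracy conjugation `γ′ ↦ diag(t,1) γ′ diag(t,1)⁻¹` (namely `γ = δ(γ′)` with `γ′ = (a, b/t; tc, d)`).
[cite: SerreTrees1980, Ch. II §1.4 Thm. 3] -/
theorem mem_range_degeneracyConj_of_dvd [NeZero t] (γ : Gamma0 L') (h : (t : ℤ) ∣ (γ : SL(2, ℤ)) 0 1) :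
    γ ∈ (Gamma0.degeneracyConj L' (L' * t) t dvd_rfl).range := by
  obtain ⟨b', hb'⟩ := h
  have ht0 : (t : ℤ) ≠ 0 := by exact_mod_cast (Fact.out : t.Prime).ne_zero
  have hL : (L' : ℤ) ∣ (γ : SL(2, ℤ)) 1 0 := by
    have hγ := γ.2
    rw [Gamma0_mem] at hγ
    exact (ZMod.intCast_zmod_eq_zero_iff_dvd _ _).mp hγ
  have hdet : (γ : SL(2, ℤ)) 0 0 * (γ : SL(2, ℤ)) 1 1 - (γ : SL(2, ℤ)) 0 1 * (γ : SL(2, ℤ)) 1 0 = 1 := by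
    have := Matrix.det_fin_two ((γ : SL(2, ℤ)) : Matrix (Fin 2) (Fin 2) ℤ)
    rw [(γ : SL(2, ℤ)).det_coe] at this
    exact this.symm
  let γ' : SL(2, ℤ) := ⟨!![(γ : SL(2, ℤ)) 0 0, b'; (t : ℤ) * (γ : SL(2, ℤ)) 1 0, (γ : SL(2, ℤ)) 1 1], by
    rw [Matrix.det_fin_two_of]
    rw [hb'] at hdet
    linear_combination hdet⟩
  have hγ' : γ' ∈ Gamma0 (L' * t) := by
    rw [Gamma0_mem]
    refine (ZMod.intCast_zmod_eq_zero_iff_dvd _ _).mpr ?_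
    show ((L' * t : ℕ) : ℤ) ∣ (t : ℤ) * (γ : SL(2, ℤ)) 1 0
    push_cast
    rw [mul_comm (L' : ℤ)]
    exact mul_dvd_mul_left _ hL
  refine ⟨⟨γ', hγ'⟩, ?_⟩
  apply Subtype.ext
  apply Matrix.SpecialLinearGroup.ext
  intro i j
  rw [Gamma0.degeneracyConj_apply]
  fin_cases i <;> fin_cases j
  · rfl
  · show (t : ℤ) * b' = (γ : SL(2, ℤ)) 0 1
    rw [hb']
  · show (t : ℤ) * (γ : SL(2, ℤ)) 1 0 / (t : ℤ) = (γ : SL(2, ℤ)) 1 0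
    rw [mul_comm]; exact Int.mul_ediv_cancel _ ht0
  · rfl

/-- `ι : SL₂(ℤ) → SL₂(ℤ[1/t])` is injective (plumbing). [cite: SerreTrees1980, Ch. II §1.4] -/
theorem map_injective : Function.Injective
    (Matrix.SpecialLinearGroup.map (Int.castRingHom (Localization.Away (t : ℤ))) :
      SL(2, ℤ) → SL(2, Localization.Away (t : ℤ))) := by
  intro γ₁ γ₂ h
  ext i j
  have e := congrArg (fun g : SL(2, Localization.Away (t : ℤ)) => g i j) h
  simp only [map_apply_int] at e
  exact Automorphic.algebraMap_int_away_injective (Fact.out : t.Prime).ne_zero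
    (by simpa only [eq_intCast] using e)

end Amalgam

end Gamma0Away

open Gamma0Away in
/-- **E-es-43 / the abelianised Ihara–Serre amalgam, PROVED**: a `t`-shift-invariant additive character of
`Γ₀(L′)` extends additively to `Γ₀(L′; ℤ[1/t])` (`t` prime, `t ∤ L′`, any field `K`).  Proof: the amalgam
`P = Γ₀(L′) *_{Γ₀(L′t)} Γ₀(L′)` along (inclusion, `diag(t,1)·diag(t,1)⁻¹`) maps to `SL₂(ℤ[1/t])` by
`ψ = (ι, θ∘ι)` (`theta_map_degeneracyConj`); the characters `(u, u)` are compatible on `Γ₀(L′t)` by the hypothesis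
`π_t^* u = π_1^* u`, so `PushoutI.lift` is defined on `P`; by the ping-pong of `Gamma0AwayPingPong.lean` it
factors through `ψ(P)` (`Amalgam.exists_extension_of_pingPong`), and `ψ(P) ⊇ Γ₀(L′; ℤ[1/t])`
(`Gamma0Away.mem_of_apply_one_zero`). [cite: SerreTrees1980, Ch. I §4.1 Thm. 6, Ch. II §1.4 Thm. 3] -/
theorem gamma0Away_character_extension_of_shiftInvariant_holds :
    gamma0Away_character_extension_of_shiftInvariant := by
  intro t ht K _ L' _ _ htL u hu
  haveI : Fact t.Prime := ⟨ht⟩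
  -- the amalgam data
  let φ : ∀ _ : Bool, Gamma0 (L' * t) →* Gamma0 L' := fun b =>
    cond b (Gamma0.degeneracyConj L' (L' * t) t dvd_rfl)
      (Gamma0.degeneracyConj L' (L' * t) 1 (mul_dvd_mul_left L' (one_dvd t)))
  have hφ : ∀ b, Function.Injective (φ b) := amalgamMaps_injective t L'
  let ιΓ : Gamma0 L' →* SL(2, Localization.Away (t : ℤ)) :=
    (Matrix.SpecialLinearGroup.map (Int.castRingHom (Localization.Away (t : ℤ)))).comp (Gamma0 L').subtype
  let ιΓ' : Gamma0 (L' * t) →* SL(2, Localization.Away (t : ℤ)) :=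
    (Matrix.SpecialLinearGroup.map (Int.castRingHom (Localization.Away (t : ℤ)))).comp
      (Gamma0 (L' * t)).subtype
  let f : ∀ _ : Bool, Gamma0 L' →* SL(2, Localization.Away (t : ℤ)) := fun b =>
    cond b ((theta t).comp ιΓ) ιΓ
  have hf : ∀ b, (f b).comp (φ b) = ιΓ' := by
    intro b
    cases b
    · ext γ : 1
      show Matrix.SpecialLinearGroup.map (Int.castRingHom (Localization.Away (t : ℤ)))
          ((Gamma0.degeneracyConj L' (L' * t) 1 (mul_dvd_mul_left L' (one_dvd t)) γ : Gamma0 L') : SL(2, ℤ))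
        = Matrix.SpecialLinearGroup.map (Int.castRingHom (Localization.Away (t : ℤ))) (γ : SL(2, ℤ))
      rw [Gamma0.coe_degeneracyConj_one]
    · ext γ : 1
      exact theta_map_degeneracyConj t L' γ
  let ψ : PushoutI φ →* SL(2, Localization.Away (t : ℤ)) := PushoutI.lift f ιΓ' hf
  have hψ_false : ∀ γ : Gamma0 L', ψ (PushoutI.of (φ := φ) false γ) =
      Matrix.SpecialLinearGroup.map (Int.castRingHom (Localization.Away (t : ℤ))) (γ : SL(2, ℤ)) :=
    fun γ => by simp [ψ, f, ιΓ]
  have hψ_true : ∀ γ : Gamma0 L', ψ (PushoutI.of (φ := φ) true γ) =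
      theta t (Matrix.SpecialLinearGroup.map (Int.castRingHom (Localization.Away (t : ℤ))) (γ : SL(2, ℤ))) :=
    fun γ => by simp [ψ, f, ιΓ]
  have hψ_base : ∀ c : Gamma0 (L' * t), ψ (PushoutI.base φ c) =
      Matrix.SpecialLinearGroup.map (Int.castRingHom (Localization.Away (t : ℤ))) (c : SL(2, ℤ)) :=
    fun c => by simp [ψ, ιΓ']
  -- the characters
  let uHom : Gamma0 L' →* Multiplicative K := AddMonoidHom.toMultiplicativeRight (cocyclesZeroEquiv L' K u)
  have huHom : ∀ γ, uHom γ = Multiplicative.ofAdd ((u : Gamma0 L' → Fin 1 → K) γ 0) := fun γ => rfl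
  let f' : ∀ _ : Bool, Gamma0 L' →* Multiplicative K := fun _ => uHom
  have hf' : ∀ b, (f' b).comp (φ b) = uHom.comp (φ false) := by
    intro b
    cases b
    · rfl
    · ext γ : 1
      simp only [MonoidHom.comp_apply, huHom, f', φ, cond_true, cond_false]
      have h1 := congrFun hu γ
      rw [degeneracyPullback_zero_apply, degeneracyPullback_zero_apply] at h1
      rw [h1]
  -- the ping-pong hypotheses
  obtain ⟨Φ, hmul, hof, -⟩ := Amalgam.exists_extension_of_pingPong hφ ψ {g | TopHeavy t g} (height t)
    (fun γ => by
      rw [hψ_false]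
      exact ⟨not_topHeavy_map t _, by rw [height_map, height_one]⟩)
    (fun γ hγ x hx => by
      rw [hψ_false]
      refine not_topHeavy_map_mul t _ (fun hd => hγ ?_) hx
      exact mem_range_inclusion_of_dvd t L' htL γ hd)
    (fun γ hγ x hx => by
      rw [hψ_true]
      refine topHeavy_theta_map_mul t _ (fun hd => hγ ?_) hx
      exact mem_range_degeneracyConj_of_dvd t L' γ hd)
    (fun c x => by
      rw [hψ_base]
      refine topHeavy_map_mul_iff t _ ?_ x
      have hc := c.2
      rw [Gamma0_mem] at hc
      exact dvd_trans (by push_cast; exact dvd_mul_left _ _) ((ZMod.intCast_zmod_eq_zero_iff_dvd _ _).mp hc))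
    (fun γ hγ => by
      rw [hψ_false] at hγ
      have := map_injective t (hγ.trans (map_one _).symm)
      exact Subtype.ext this)
    f' (uHom.comp (φ false)) hf'
  -- generation: `Γ₀(L′; ℤ[1/t]) ⊆ ψ(P)`
  have hS : ∀ γ : SL(2, ℤ), γ ∈ Gamma0 L' →
      Matrix.SpecialLinearGroup.map (Int.castRingHom (Localization.Away (t : ℤ))) γ ∈ ψ.range :=
    fun γ hγ => ⟨PushoutI.of (φ := φ) false ⟨γ, hγ⟩, hψ_false ⟨γ, hγ⟩⟩
  have hS' : ∀ γ : SL(2, ℤ), γ ∈ Gamma0 L' →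
      theta t (Matrix.SpecialLinearGroup.map (Int.castRingHom (Localization.Away (t : ℤ))) γ) ∈ ψ.range :=
    fun γ hγ => ⟨PushoutI.of (φ := φ) true ⟨γ, hγ⟩, hψ_true ⟨γ, hγ⟩⟩
  refine ⟨fun g => Multiplicative.toAdd (Φ g), ?_, ?_⟩
  · intro g hg g' hg'
    have hgm := mem_of_apply_one_zero t ψ.range hS hS' htL g hg
    have hgm' := mem_of_apply_one_zero t ψ.range hS hS' htL g' hg'
    show Multiplicative.toAdd (Φ (g * g')) = Multiplicative.toAdd (Φ g) + Multiplicative.toAdd (Φ g')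
    rw [hmul g hgm g' hgm', toAdd_mul]
  · intro γ
    have := hof false γ
    rw [hψ_false] at this
    show Multiplicative.toAdd (Φ _) = _
    rw [this]
    rfl

end Literature.NumberTheory.EllipticCurves

end
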